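import Summits.HodgeConjecture.CorCM.MultiFieldWeilUnitsMenuShapesFree
import Summits.HodgeConjecture.CorCM.MultiFieldWeilSexticSimple
import HarnessLib

/-!
# MULTI-FIELD WEIL ENGINE — THE UNITS MENU BY SHAPES WITH NEITHER CROSS-DEGREE NOR SIMPLICITY HYPOTHESES: finitely many CM fields `K_j ∋ k` with `2`-transitive sextic ∕
# quartic ∕ quintic parts, per field a list of pairwise non-isogenous structures of the prescribed shapes, `Hom = ∅` within a degree — the Hodge conjecture for every product of
# copies, given only Markman's fourfold and hyperbolic-sixfold theorems

Cell `pub-hodgecm2` (COR-CM), seat b30 gen 41 (2026-08-26); count-neutral own lane MULTI-FIELD WEIL ENGINE (stem `MultiFieldWeil*`).  D4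
(`CorCM/MultiFieldWeilUnitsMenuShapesFree.lean`, `hodgeConjectureFor_biproduct_sigma_free_of_shapes`) with its binder `hS` («the sextic structures are SIMPLE») DISCHARGED by D10
(`CorCM/MultiFieldWeilSexticSimple.lean`, `isSimple_of_sextic_of_card_filter_eq_one`: one type member over `τ` over a sextic field through `k` ⟹ simple).  Theorems only; no
definition, no named fact, no `sorry`.  HONEST FRAMING: conditional ONLY on the two displayed Markman binders; `HC_CM` is NOT proved and not asserted.

**`hodgeConjectureFor_biproduct_sigma_free_of_shapes_noSimple`.**  `k` imaginary quadratic with `τ`, `E ⊨ (k; {τ})`; `J` finite; CM fields `KJ j ⊇ iK j (k)` of degree `2·nJ j`;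
structures `B j t ⊨ (KJ j; Ψ j t)`, `t : Fin (c j)`, with `(nJ j, p_{j,t}) ∈ {(3,1), (4,1), (4,2), (5,2)}` (types NORMALISED), pairwise NON-ISOGENOUS within a field; SHAPES
`c j ≤ 2` (sextic), `c j ≤ 3` (octic; separation `hsep`), `c j ≤ 4` (decic; (H1) `hmeet`, (H2) `hodd` when `c j = 4`); octic fields with a degree-`24` pair, decic fields with
`c j ≥ 2` with a degree-`40` pair; `Hom(KJ j', KJ j) = ∅` for `j ≠ j'` OF EQUAL DEGREE.  No simplicity hypothesis, nothing between fields of different degrees.  THEN the Hodge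
conjecture holds for `⨁_l X_l`, every `X_l ∈ {E} ∪ {B j t}`, and for everything dominated, GIVEN ONLY Markman's two theorems.
[cite: Markman2025SurveySecant, Thm. 1.2] [cite: Markman2025SecantWeil, Thm 1.5.1] [cite: Shimura1998, §6.1 Corollary of Theorem 2, §8.2 Prop. 26, §8.4, §18.2 Lemma (i)]
[cite: Serre1977, §2.2 Cor. 2–3 of Prop. 4; §2.3 Ex. 2.6] [cite: Deligne1982HodgeCycles, §5 (b)] [cite: Lang2002, VI §1 Thm. 1.14 and V §2 Thm. 2.8; XIII §4; XV §1]
[cite: MoonenZarhin1995Duke, Thm. 2.4] [cite: Pohlmann1968, Thm 1] [cite: DixonMortimer1996, §1.4 Ex. 1.4.1–1.4.2; §1.6, Thm. 1.6A; §2.1; §3.3, Thm. 3.3A]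
[cite: Dodson1984, §1.1 Imprimitivity Theorem and §5.1.2 Theorem] [cite: MumfordAV1970, §19]

## References
* [Markman2025SurveySecant] E. Markman, arXiv:2509.23403, Thm. 1.2.  [Markman2025SecantWeil] E. Markman, Cycles on abelian 2n-folds of Weil type from secant sheaves on abelian
  n-folds, Thm 1.5.1.  [Shimura1998] G. Shimura, *Abelian varieties with complex multiplication and modular functions*, §6.1, §8.2, §8.4, §18.2.  [Serre1977] J.-P. Serre,
  *Linear Representations of Finite Groups*, GTM 42, §2.2–§2.3.  [Deligne1982HodgeCycles] P. Deligne, LNM 900, §5 (b).  [Lang2002] S. Lang, *Algebra*, GTM 211, V §2, VI §1,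
  XIII §4, XV §1.  [MoonenZarhin1995Duke] B. Moonen, Yu. Zarhin, Duke Math. J. 77 (1995), Thm. 2.4.  [Pohlmann1968] H. Pohlmann, Ann. of Math. 88 (1968), Thm 1.
  [DixonMortimer1996] J. D. Dixon, B. Mortimer, *Permutation Groups*, GTM 163.  [Dodson1984] B. Dodson, Trans. AMS 283 (1984).  [MumfordAV1970] D. Mumford, *Abelian
  Varieties*, §19.
-/

noncomputable section

open CategoryTheory CategoryTheory.Limits NumberField IntermediateField

namespace Summit.HodgeConjecture.CorCM.MultiFieldWeil

open Finset
open Literature.AlgebraicGeometry Literature.AlgebraicGeometry.Motives Literature.AlgebraicGeometry.HodgeTheory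
open Literature.AlgebraicGeometry.ComplexMultiplication (IsCMTypeRealisation)
open Literature.AlgebraicTopology.SingularHomology
open Literature.NumberTheory.ComplexMultiplication

open scoped Classical

section Shapes

variable {J : Type} [Fintype J] {KJ : J → Type} [fK : ∀ j, Field (KJ j)] [nK : ∀ j, NumberField (KJ j)] [cK : ∀ j, IsCMField (KJ j)]
  {k : Type} [fk : Field k] [nk : NumberField k] [ck : IsCMField k] {τ : k →+* ℂ} {c : J → ℕ}
  {B : ∀ j : J, Fin (c j) → AbelianVariety ℂ} {Ψ : ∀ j : J, Fin (c j) → CMType (KJ j)}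
  {ιB : ∀ (j : J) (t : Fin (c j)), 𝓞 (KJ j) →+* End (B j t)} {θB : ∀ (j : J) (t : Fin (c j)), KJ j →+* Module.End ℂ (complexBetti (B j t).X 1)}
  {E : AbelianVariety ℂ} {Φ₀ : CMType k} {ιE : 𝓞 k →+* End E} {θE : k →+* Module.End ℂ (complexBetti E.X 1)}

/-- **THE UNITS MENU BY SHAPES WITH NEITHER CROSS-DEGREE NOR SIMPLICITY HYPOTHESES — GIVEN ONLY MARKMAN'S FOURFOLD AND HYPERBOLIC-SIXFOLD THEOREMS.**  See the module
docstring.  `HC_CM` is NOT asserted. [cite: Markman2025SurveySecant, Thm. 1.2] [cite: Markman2025SecantWeil, Thm 1.5.1] [cite: Shimura1998, §6.1 Corollary of Theorem 2, §8.2 Prop. 26, §18.2]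
[cite: Serre1977, §2.2 Cor. 2–3 of Prop. 4; §2.3 Ex. 2.6] [cite: DixonMortimer1996, §1.4 Ex. 1.4.1–1.4.2; §1.6, Thm. 1.6A; §2.1] [cite: Lang2002, XIII §4; XV §1] -/
theorem hodgeConjectureFor_biproduct_sigma_free_of_shapes_noSimple (hW4 : Markman2025_weilClasses_algebraic_abelianFourfold)
    (hM6 : Markman2025_weilClasses_algebraic_hyperbolicSixfold) (h2 : Module.finrank ℚ k = 2) (iK : ∀ j : J, k →+* KJ j) (nJ : J → ℕ)
    (hdeg : ∀ j, Module.finrank ℚ (KJ j) = 2 * nJ j) (hB : ∀ j t, IsCMTypeRealisation (Ψ j t) (B j t) (ιB j t) (θB j t))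
    (hE : IsCMTypeRealisation Φ₀ E ιE θE) (hΦ₀ : ∀ σ : k →+* ℂ, σ ∈ Φ₀.1 ↔ σ = τ)
    (hcnt : ∀ j t, (nJ j = 3 ∧ (Finset.univ.filter fun s : KJ j →+* ℂ => s.comp (iK j) = τ ∧ s ∈ (Ψ j t).1).card = 1) ∨
      (nJ j = 4 ∧ (Finset.univ.filter fun s : KJ j →+* ℂ => s.comp (iK j) = τ ∧ s ∈ (Ψ j t).1).card = 1) ∨
      (nJ j = 4 ∧ (Finset.univ.filter fun s : KJ j →+* ℂ => s.comp (iK j) = τ ∧ s ∈ (Ψ j t).1).card = 2) ∨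
      (nJ j = 5 ∧ (Finset.univ.filter fun s : KJ j →+* ℂ => s.comp (iK j) = τ ∧ s ∈ (Ψ j t).1).card = 2))
    (hni : ∀ j t t', t ≠ t' → ¬ AbelianVariety.IsIsogenous (B j t) (B j t'))
    (hc3 : ∀ j, nJ j = 3 → c j ≤ 2) (hc4 : ∀ j, nJ j = 4 → c j ≤ 3) (hc5 : ∀ j, nJ j = 5 → c j ≤ 4)
    (hsep : ∀ j, nJ j = 4 → ∀ t₁ t₂ t₃ : Fin (c j), t₁ ≠ t₂ → (Finset.univ.filter fun u : KJ j →+* ℂ => u.comp (iK j) = τ ∧ u ∈ (Ψ j t₁).1).card = 1 →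
      (Finset.univ.filter fun u : KJ j →+* ℂ => u.comp (iK j) = τ ∧ u ∈ (Ψ j t₂).1).card = 1 →
      (Finset.univ.filter fun u : KJ j →+* ℂ => u.comp (iK j) = τ ∧ u ∈ (Ψ j t₃).1).card = 2 →
      ∀ s₁ s₂ : KJ j →+* ℂ, s₁.comp (iK j) = τ → s₂.comp (iK j) = τ → s₁ ∈ (Ψ j t₁).1 → s₂ ∈ (Ψ j t₂).1 → (s₁ ∈ (Ψ j t₃).1 ↔ s₂ ∉ (Ψ j t₃).1))
    (hmeet : ∀ j, nJ j = 5 → c j = 4 → ∀ t : Fin (c j), ∃ t', t' ≠ t ∧ ∃ s : KJ j →+* ℂ, s.comp (iK j) = τ ∧ s ∈ (Ψ j t).1 ∧ s ∈ (Ψ j t').1)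
    (hodd : ∀ j, nJ j = 5 → c j = 4 → ∃ s : KJ j →+* ℂ, s.comp (iK j) = τ ∧ (Finset.univ.filter fun t : Fin (c j) => s ∈ (Ψ j t).1).card ≠ 0 ∧
      (Finset.univ.filter fun t : Fin (c j) => s ∈ (Ψ j t).1).card ≠ 2)
    (h24 : ∀ j, nJ j = 4 → ∃ s₀ t₀ : KJ j →+* ℂ, s₀.comp (iK j) = τ ∧ t₀.comp (iK j) = τ ∧ s₀ ≠ t₀ ∧
      Module.finrank ℚ ↥(adjoin ℚ (Set.range τ) ⊔ adjoin ℚ (Set.range s₀ ∪ Set.range t₀)) = 24)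
    (h40 : ∀ j, nJ j = 5 → 1 < c j → ∃ s₀ t₀ : KJ j →+* ℂ, s₀.comp (iK j) = τ ∧ t₀.comp (iK j) = τ ∧ s₀ ≠ t₀ ∧
      Module.finrank ℚ ↥(adjoin ℚ (Set.range τ) ⊔ adjoin ℚ (Set.range s₀ ∪ Set.range t₀)) = 40)
    (hiso : ∀ j j' : J, j' ≠ j → nJ j = nJ j' → IsEmpty (KJ j' →+* KJ j))
    {N : ℕ} (κ : Fin N → Option ((j : J) × Fin (c j))) :
    HodgeConjectureFor (⨁ fun l => ((κ l).elim E fun x => B x.1 x.2 : AbelianVariety ℂ)).dim (⨁ fun l => ((κ l).elim E fun x => B x.1 x.2 : AbelianVariety ℂ)).X :=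
  hodgeConjectureFor_biproduct_sigma_free_of_shapes hW4 hM6 h2 iK nJ hdeg hB hE hΦ₀
    (fun j h3 t => isSimple_of_sextic_of_card_filter_eq_one (by rw [hdeg j, h3]) h2 (iK j) τ (hB j t)
      (by rcases hcnt j t with ⟨-, h⟩ | ⟨h, -⟩ | ⟨h, -⟩ | ⟨h, -⟩ <;> omega))
    hcnt hni hc3 hc4 hc5 hsep hmeet hodd h24 h40 hiso κ

/-- **Dominated form.** [cite: Markman2025SurveySecant, Thm. 1.2] [cite: Markman2025SecantWeil, Thm 1.5.1] [cite: MumfordAV1970, §19] -/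
theorem hodgeConjectureFor_of_avDominatedBy_sigma_free_of_shapes_noSimple (hW4 : Markman2025_weilClasses_algebraic_abelianFourfold)
    (hM6 : Markman2025_weilClasses_algebraic_hyperbolicSixfold) (h2 : Module.finrank ℚ k = 2) (iK : ∀ j : J, k →+* KJ j) (nJ : J → ℕ)
    (hdeg : ∀ j, Module.finrank ℚ (KJ j) = 2 * nJ j) (hB : ∀ j t, IsCMTypeRealisation (Ψ j t) (B j t) (ιB j t) (θB j t))
    (hE : IsCMTypeRealisation Φ₀ E ιE θE) (hΦ₀ : ∀ σ : k →+* ℂ, σ ∈ Φ₀.1 ↔ σ = τ)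
    (hcnt : ∀ j t, (nJ j = 3 ∧ (Finset.univ.filter fun s : KJ j →+* ℂ => s.comp (iK j) = τ ∧ s ∈ (Ψ j t).1).card = 1) ∨
      (nJ j = 4 ∧ (Finset.univ.filter fun s : KJ j →+* ℂ => s.comp (iK j) = τ ∧ s ∈ (Ψ j t).1).card = 1) ∨
      (nJ j = 4 ∧ (Finset.univ.filter fun s : KJ j →+* ℂ => s.comp (iK j) = τ ∧ s ∈ (Ψ j t).1).card = 2) ∨
      (nJ j = 5 ∧ (Finset.univ.filter fun s : KJ j →+* ℂ => s.comp (iK j) = τ ∧ s ∈ (Ψ j t).1).card = 2))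
    (hni : ∀ j t t', t ≠ t' → ¬ AbelianVariety.IsIsogenous (B j t) (B j t'))
    (hc3 : ∀ j, nJ j = 3 → c j ≤ 2) (hc4 : ∀ j, nJ j = 4 → c j ≤ 3) (hc5 : ∀ j, nJ j = 5 → c j ≤ 4)
    (hsep : ∀ j, nJ j = 4 → ∀ t₁ t₂ t₃ : Fin (c j), t₁ ≠ t₂ → (Finset.univ.filter fun u : KJ j →+* ℂ => u.comp (iK j) = τ ∧ u ∈ (Ψ j t₁).1).card = 1 →
      (Finset.univ.filter fun u : KJ j →+* ℂ => u.comp (iK j) = τ ∧ u ∈ (Ψ j t₂).1).card = 1 →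
      (Finset.univ.filter fun u : KJ j →+* ℂ => u.comp (iK j) = τ ∧ u ∈ (Ψ j t₃).1).card = 2 →
      ∀ s₁ s₂ : KJ j →+* ℂ, s₁.comp (iK j) = τ → s₂.comp (iK j) = τ → s₁ ∈ (Ψ j t₁).1 → s₂ ∈ (Ψ j t₂).1 → (s₁ ∈ (Ψ j t₃).1 ↔ s₂ ∉ (Ψ j t₃).1))
    (hmeet : ∀ j, nJ j = 5 → c j = 4 → ∀ t : Fin (c j), ∃ t', t' ≠ t ∧ ∃ s : KJ j →+* ℂ, s.comp (iK j) = τ ∧ s ∈ (Ψ j t).1 ∧ s ∈ (Ψ j t').1)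
    (hodd : ∀ j, nJ j = 5 → c j = 4 → ∃ s : KJ j →+* ℂ, s.comp (iK j) = τ ∧ (Finset.univ.filter fun t : Fin (c j) => s ∈ (Ψ j t).1).card ≠ 0 ∧
      (Finset.univ.filter fun t : Fin (c j) => s ∈ (Ψ j t).1).card ≠ 2)
    (h24 : ∀ j, nJ j = 4 → ∃ s₀ t₀ : KJ j →+* ℂ, s₀.comp (iK j) = τ ∧ t₀.comp (iK j) = τ ∧ s₀ ≠ t₀ ∧
      Module.finrank ℚ ↥(adjoin ℚ (Set.range τ) ⊔ adjoin ℚ (Set.range s₀ ∪ Set.range t₀)) = 24)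
    (h40 : ∀ j, nJ j = 5 → 1 < c j → ∃ s₀ t₀ : KJ j →+* ℂ, s₀.comp (iK j) = τ ∧ t₀.comp (iK j) = τ ∧ s₀ ≠ t₀ ∧
      Module.finrank ℚ ↥(adjoin ℚ (Set.range τ) ⊔ adjoin ℚ (Set.range s₀ ∪ Set.range t₀)) = 40)
    (hiso : ∀ j j' : J, j' ≠ j → nJ j = nJ j' → IsEmpty (KJ j' →+* KJ j))
    {N : ℕ} (κ : Fin N → Option ((j : J) × Fin (c j))) {X : AbelianVariety ℂ}
    (hX : Domination.AVDominatedBy X (⨁ fun l => ((κ l).elim E fun x => B x.1 x.2 : AbelianVariety ℂ))) : HodgeConjectureFor X.dim X.X :=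
  Domination.hodgeConjectureFor_of_avDominatedBy
    (hodgeConjectureFor_biproduct_sigma_free_of_shapes_noSimple hW4 hM6 h2 iK nJ hdeg hB hE hΦ₀ hcnt hni hc3 hc4 hc5 hsep hmeet hodd h24 h40 hiso κ) hX

end Shapes

end Summit.HodgeConjecture.CorCM.MultiFieldWeil

end
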